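import Summits.CriticalPhenomena.PercolationContinuityZ3.Theorems.Transplant.HeisenbergSkeletonConc
import Summits.CriticalPhenomena.PercolationContinuityZ3.Theorems.Transplant.HeisenbergCriticalProbLtOne
import Summits.CriticalPhenomena.PercolationContinuityZ3.Theorems.Transplant.CubicLatticesCylinder
import Summits.CriticalPhenomena.PercolationContinuityZ3.Theorems.Transplant.TranslationInvariantAmenable
import Literature.Probability.Percolation.CoveringTameFibres
import Literature.Barriers.CriticalPhenomena.BLPSCriticalReduction
import Mathlib.Tactic.FinCases
import HarnessLib

/-!
# `θ(p_c) = 0` on EVERY `D₄`-symmetric unit-step Cayley graph of the Heisenberg group `H₃(ℤ)`, from the node of record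
# `SamePDropOfSkeletonConcLt` (class C2, P3-NILPOTENT §12.5 (c): the dependence on the generating set)

builds on p205010 (kernel theorem, internal audit signed; external expert review pending) — nothing in this file uses p205010.
Lane `prim-bschramm`, seat `prim-bschramm-p3` (gen 6; class C2 = polynomial-growth Cayley graphs), helper file
(`--supports stmt-CriticalPhenomena-4575`).  NEW FILE over `HeisenbergSkeletonConc` (p4's instance for the standard generators `{a^±, b^±}`).

A finite `S ⊆ H₃(ℤ)` is **admissible** when it is symmetric (`s ∈ S ⇒ s⁻¹ ∈ S`), contains `a = (1,0,0)` and `b = (0,1,0)`, every `s ∈ S`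
moves the abelianisation by a unit step (`|s₁|, |s₂| ≤ 1`), and `S` is invariant under the two automorphisms `σ : (x,y,z) ↦ (y,x,xy−z)`,
`τ : (x,y,z) ↦ (−x,y,−z)` generating the `D₄` of §1 of P3-NILPOTENT (examples: `{a,b}^±`; `{a,b,c}^±` with the central `c = (0,0,1)`;
`{a, b, ab, ba, …}^±` closed up under `σ, τ`; any of these with central elements `c^{±k}` added).  For the right Cayley graph
`Cay(H₃(ℤ); S)` (`g ∼ g·s`):
* `HeisGens.graph S`, `graph_adj_iff`, local finiteness, `cayleyGraph ≤ graph S`, `graph_connected`; the automorphisms `leftIso`, `swapIso`,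
  `flipIso`, the lifted point group `pointIso` (= p4's `heisPointIso` as a function) and `heisAb_pointIso`; `admissible_std`, `admissible_abc`;
* **`skeletonConc hS : PlanarSkeletonConc (graph S)`** (`φ = heisAb`, one type, frames = left translations, point group `D₄`, `Δ = 2|S|`,
  steps `a^{±1}, b^{±1}`, cylinders `{|x|,|y| ≤ ℓ}` connected for `ℓ ≥ 1` by p3-g4's `heisCylGraph_connected` and monotonicity).
Part 2 (`HeisenbergSymmetricGensContinuity`): input Φ2 at every `p < 1` (Lipschitz height `z`), `p_c < 1`, polynomial growth, amenability, and
**`criticalContinuity_of_skeletonConcNode : SamePDropOfSkeletonConcLt → Admissible S → ∀ x, θ_{Cay(H₃(ℤ);S)}(x, p_c) = 0`** — conditional on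
the node of record alone; NOT a corollary of the standard-generator instance (`θ(p_c) = 0` is not known to be a quasi-isometry invariant); for
generating sets WITHOUT the `D₄` symmetry (e.g. `{a, b, ab²}^±`) no `PlanarSkeleton` exists and nothing is claimed (P3-NILPOTENT §12.5 (c)).
[cite: BenjaminiSchramm1996, Conj. 4] [cite: KozmaNitzan2024, §1 p. 2 (approach 1); §4 p. 15] [cite: CheegerKleinerNaor2011, §1.1]
[cite: LyonsPeres2016, §6.1 (p. 279), Thm. 7.6] [cite: GrimmettPercolation1999, §1.4 (p_c = 1 in one dimension)]
-/

noncomputable section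

namespace Summit.CriticalPhenomena.PercolationContinuityZ3.Theorems.Transplant

open MeasureTheory Filter Literature.Probability.Percolation Literature.Probability.LatticeModels SimpleGraph
open Literature.Geometry.MetricEmbeddings (cayleyGraph cayleyGraph_connected heisMul genA genB heisInv heisMul_assoc heisMul_zero_right
  heisMul_zero_left heisMul_heisInv heisInv_heisMul heisMul_heisMul_heisInv heisMul_heisInv_heisMul heisInv_heisInv heisMul_right_injective
  heisMul_heisInv_cancel_left)
open Literature.Barriers.CriticalPhenomena (IsQuasiTransitive IsGraphAmenable IsGraphTransitive HasExponentialGrowth ballVolume graphBall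
  hasExponentialGrowth_of_not_isGraphAmenable eventually_pow_lt_const_pow)
open SameP (heisSwap heisFlip heisAb heisAb_heisMul heisSwap_heisMul heisFlip_heisMul heisSwap_heisSwap heisFlip_heisFlip heisCyl heisCylGraph)
open Literature.Probability.Percolation.GM (HOct sp)

namespace HeisGens

/-! ## §1 Admissible generating sets and their Cayley graphs -/

/-- **Admissible generating sets of `H₃(ℤ)`** (a predicate on finite subsets): symmetric, containing `a` and `b`, unit planar steps,
invariant under the `D₄` generators `σ` (`heisSwap`) and `τ` (`heisFlip`) of Cheeger–Kleiner–Naor §1.1. [this work] -/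
def Admissible (S : Finset (ℤ × ℤ × ℤ)) : Prop :=
  (∀ s ∈ S, heisInv s ∈ S) ∧ genA ∈ S ∧ genB ∈ S ∧ (∀ s ∈ S, |s.1| ≤ 1 ∧ |s.2.1| ≤ 1) ∧ (∀ s ∈ S, heisSwap s ∈ S) ∧
    ∀ s ∈ S, heisFlip s ∈ S

namespace Admissible

variable {S : Finset (ℤ × ℤ × ℤ)} (h : Admissible S)
include h

/-- `S = S⁻¹`. [folklore] -/
theorem symm : ∀ s ∈ S, heisInv s ∈ S := h.1

/-- `a ∈ S`. [folklore] -/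
theorem genA_mem : genA ∈ S := h.2.1

/-- `b ∈ S`. [folklore] -/
theorem genB_mem : genB ∈ S := h.2.2.1

/-- Unit planar steps. [folklore] -/
theorem unit : ∀ s ∈ S, |s.1| ≤ 1 ∧ |s.2.1| ≤ 1 := h.2.2.2.1

/-- `σ S = S`. [folklore] -/
theorem swap : ∀ s ∈ S, heisSwap s ∈ S := h.2.2.2.2.1

/-- `τ S = S`. [folklore] -/
theorem flip : ∀ s ∈ S, heisFlip s ∈ S := h.2.2.2.2.2

end Admissible

/-- **The standard generators are admissible**: `S₀ = {a, b, a⁻¹, b⁻¹}`. [cite: CheegerKleinerNaor2011, §1.1] -/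
theorem admissible_std : Admissible ({genA, genB, heisInv genA, heisInv genB} : Finset (ℤ × ℤ × ℤ)) := by
  refine ⟨?_, by simp, by simp, ?_, ?_, ?_⟩ <;> intro s hs <;>
    simp only [Finset.mem_insert, Finset.mem_singleton] at hs <;> rcases hs with rfl | rfl | rfl | rfl <;>
    simp [genA, genB, heisInv, heisSwap, heisFlip]

/-- **The generators `{a, b, c}^{±1}` with the central `c = (0,0,1)` are admissible.** [cite: CheegerKleinerNaor2011, §1.1] -/
theorem admissible_abc : Admissible ({genA, genB, heisInv genA, heisInv genB, (0, 0, 1), (0, 0, -1)} : Finset (ℤ × ℤ × ℤ)) := by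
  refine ⟨?_, by simp, by simp, ?_, ?_, ?_⟩ <;> intro s hs <;>
    simp only [Finset.mem_insert, Finset.mem_singleton] at hs <;> rcases hs with rfl | rfl | rfl | rfl | rfl | rfl <;>
    simp [genA, genB, heisInv, heisSwap, heisFlip]

variable (S : Finset (ℤ × ℤ × ℤ))

/-- **The right Cayley graph `Cay(H₃(ℤ); S)`**: `g ∼ g·s`, `s ∈ S` (`fromRel` symmetrises and removes loops). [cite: BenjaminiSchramm1996, §2] -/
def graph : SimpleGraph (ℤ × ℤ × ℤ) := SimpleGraph.fromRel fun g h => ∃ s ∈ S, h = heisMul g s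

variable {S}

/-- Adjacency (no hypothesis on `S`): `g ∼ h` iff `g ≠ h` and `h = g·s` or `g = h·s` for some `s ∈ S`. [folklore] -/
theorem graph_adj_iff₀ (g h : ℤ × ℤ × ℤ) :
    (graph S).Adj g h ↔ g ≠ h ∧ ((∃ s ∈ S, h = heisMul g s) ∨ ∃ s ∈ S, g = heisMul h s) := by
  rw [graph, SimpleGraph.fromRel_adj]

/-- Adjacency for a SYMMETRIC `S`: `g ∼ h` iff `g ≠ h` and `h = g·s` for some `s ∈ S`. [folklore] -/
theorem graph_adj_iff (hsymm : ∀ s ∈ S, heisInv s ∈ S) (g h : ℤ × ℤ × ℤ) :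
    (graph S).Adj g h ↔ g ≠ h ∧ ∃ s ∈ S, h = heisMul g s := by
  rw [graph_adj_iff₀]
  refine ⟨fun ⟨hne, h'⟩ => ⟨hne, ?_⟩, fun ⟨hne, h'⟩ => ⟨hne, Or.inl h'⟩⟩
  rcases h' with h' | ⟨s, hs, rfl⟩
  · exact h'
  · exact ⟨heisInv s, hsymm s hs, (heisMul_heisMul_heisInv h s).symm⟩

/-- The neighbours of `g` lie among `g·s` and `g·s⁻¹`, `s ∈ S`. [folklore] -/
theorem neighborSet_graph_subset (g : ℤ × ℤ × ℤ) :
    (graph S).neighborSet g ⊆ ↑(S.image (heisMul g) ∪ S.image fun s => heisMul g (heisInv s)) := by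
  intro h hh
  rw [SimpleGraph.mem_neighborSet, graph_adj_iff₀] at hh
  rw [Finset.coe_union, Finset.coe_image, Finset.coe_image]
  rcases hh.2 with ⟨s, hs, rfl⟩ | ⟨s, hs, rfl⟩
  · exact Or.inl ⟨s, hs, rfl⟩
  · exact Or.inr ⟨s, hs, (heisMul_heisMul_heisInv h s)⟩

/-- `Cay(H₃; S)` is locally finite (neighbours among `g·s^{±1}`). [folklore] -/
instance graph_locallyFinite : (graph S).LocallyFinite := fun g =>
  ((S.image (heisMul g) ∪ S.image fun s => heisMul g (heisInv s)).finite_toSet.subset (neighborSet_graph_subset g)).fintype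

/-- Induced subgraphs of `Cay(H₃; S)` are locally finite. [folklore] -/
instance graph_induce_locallyFinite (s : Set (ℤ × ℤ × ℤ)) : ((graph S).induce s).LocallyFinite := fun x =>
  Fintype.ofInjective (fun y : ((graph S).induce s).neighborSet x => (⟨y.1.1, y.2⟩ : (graph S).neighborSet x.1))
    fun y y' h => by
      have h' := congrArg (fun z : (graph S).neighborSet x.1 => (z : ℤ × ℤ × ℤ)) h
      exact Subtype.ext (Subtype.ext h')

/-- Degrees are at most `2 |S|`. [folklore] -/
theorem degree_le (g : ℤ × ℤ × ℤ) : (graph S).degree g ≤ 2 * S.card := by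
  classical
  have h1 : ((graph S).neighborFinset g).card ≤ (S.image (heisMul g) ∪ S.image fun s => heisMul g (heisInv s)).card := by
    refine Finset.card_le_card fun h hh => ?_
    rw [SimpleGraph.mem_neighborFinset] at hh
    have := neighborSet_graph_subset g hh
    rwa [Finset.mem_coe] at this
  rw [← SimpleGraph.card_neighborFinset_eq_degree]
  refine h1.trans ((Finset.card_union_le _ _).trans ?_)
  have h2 := Finset.card_image_le (s := S) (f := heisMul g)
  have h3 := Finset.card_image_le (s := S) (f := fun s => heisMul g (heisInv s))
  omega

/-- The standard Cayley graph `Cay(H₃; a, b)` is a spanning subgraph of `Cay(H₃; S)` when `a, b ∈ S`. [folklore] -/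
theorem cayleyGraph_le (hA : genA ∈ S) (hB : genB ∈ S) : cayleyGraph ≤ graph S := by
  intro g h hgh
  rw [SameP.cayleyGraph_adj_iff'] at hgh
  rw [graph_adj_iff₀]
  refine ⟨hgh.1, ?_⟩
  rcases hgh.2 with (h1 | h1) | (h1 | h1)
  · exact Or.inl ⟨genA, hA, h1⟩
  · exact Or.inl ⟨genB, hB, h1⟩
  · exact Or.inr ⟨genA, hA, h1⟩
  · exact Or.inr ⟨genB, hB, h1⟩

/-- `Cay(H₃; S)` is connected when `a, b ∈ S`. [folklore] -/
theorem graph_connected (hA : genA ∈ S) (hB : genB ∈ S) : (graph S).Connected :=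
  cayleyGraph_connected.mono (cayleyGraph_le hA hB)

/-! ## §2 Automorphisms: left translations, the swap, the flip, and the lifted point group -/

/-- Left translation by `k` as an equivalence. [folklore] -/
def leftEquiv (k : ℤ × ℤ × ℤ) : (ℤ × ℤ × ℤ) ≃ (ℤ × ℤ × ℤ) where
  toFun := heisMul k
  invFun := heisMul (heisInv k)
  left_inv := fun g => heisMul_heisInv_cancel_left' k g
  right_inv := fun g => by
    show heisMul k (heisMul (heisInv k) g) = g
    exact heisMul_heisInv_cancel_left k g
where
  /-- `k⁻¹ (k g) = g`. [folklore] -/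
  heisMul_heisInv_cancel_left' (k g : ℤ × ℤ × ℤ) : heisMul (heisInv k) (heisMul k g) = g := by
    have := heisMul_heisInv_cancel_left (heisInv k) g
    rwa [heisInv_heisInv] at this

/-- **Left translations are automorphisms of every right Cayley graph.** [cite: BenjaminiSchramm1996, §2] -/
def leftIso (k : ℤ × ℤ × ℤ) : graph S ≃g graph S where
  toEquiv := leftEquiv k
  map_rel_iff' := by
    intro g h
    show (graph S).Adj (heisMul k g) (heisMul k h) ↔ (graph S).Adj g h
    simp only [graph_adj_iff₀, heisMul_assoc, (heisMul_right_injective k).eq_iff, (heisMul_right_injective k).ne_iff]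

/-- `leftIso k` acts by left multiplication. [folklore] -/
@[simp] theorem leftIso_apply (k g : ℤ × ℤ × ℤ) : leftIso (S := S) k g = heisMul k g := rfl

/-- An involutive multiplicative bijection preserving `S` preserves adjacency. [folklore] -/
theorem adj_of_hom {f : ℤ × ℤ × ℤ → ℤ × ℤ × ℤ} (hmul : ∀ g h, f (heisMul g h) = heisMul (f g) (f h)) (hinv : ∀ g, f (f g) = g)
    (hS : ∀ s ∈ S, f s ∈ S) {g h : ℤ × ℤ × ℤ} (hgh : (graph S).Adj g h) : (graph S).Adj (f g) (f h) := by
  rw [graph_adj_iff₀] at hgh ⊢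
  obtain ⟨hne, hrel⟩ := hgh
  refine ⟨fun heq => hne (by simpa [hinv] using congrArg f heq), ?_⟩
  rcases hrel with ⟨s, hs, rfl⟩ | ⟨s, hs, rfl⟩
  · exact Or.inl ⟨f s, hS s hs, hmul g s⟩
  · exact Or.inr ⟨f s, hS s hs, hmul h s⟩

/-- **The swap `σ` as an automorphism of `Cay(H₃; S)`** (`σ S = S`). [cite: CheegerKleinerNaor2011, §1.1] -/
def swapIso (hσ : ∀ s ∈ S, heisSwap s ∈ S) : graph S ≃g graph S where
  toFun := heisSwap
  invFun := heisSwap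
  left_inv := heisSwap_heisSwap
  right_inv := heisSwap_heisSwap
  map_rel_iff' := by
    intro g h
    refine ⟨fun hgh => ?_, adj_of_hom heisSwap_heisMul heisSwap_heisSwap hσ⟩
    have := adj_of_hom (S := S) heisSwap_heisMul heisSwap_heisSwap hσ hgh
    simpa only [Equiv.coe_fn_mk, heisSwap_heisSwap] using this

/-- **The flip `τ` as an automorphism of `Cay(H₃; S)`** (`τ S = S`). [cite: CheegerKleinerNaor2011, §1.1] -/
def flipIso (hτ : ∀ s ∈ S, heisFlip s ∈ S) : graph S ≃g graph S where
  toFun := heisFlip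
  invFun := heisFlip
  left_inv := heisFlip_heisFlip
  right_inv := heisFlip_heisFlip
  map_rel_iff' := by
    intro g h
    refine ⟨fun hgh => ?_, adj_of_hom heisFlip_heisMul heisFlip_heisFlip hτ⟩
    have := adj_of_hom (S := S) heisFlip_heisMul heisFlip_heisFlip hτ hgh
    simpa only [Equiv.coe_fn_mk, heisFlip_heisFlip] using this

/-- `swapIso` acts by `heisSwap`. [folklore] -/
@[simp] theorem swapIso_apply (hσ : ∀ s ∈ S, heisSwap s ∈ S) (g : ℤ × ℤ × ℤ) : swapIso hσ g = heisSwap g := rfl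

/-- `flipIso` acts by `heisFlip`. [folklore] -/
@[simp] theorem flipIso_apply (hτ : ∀ s ∈ S, heisFlip s ∈ S) (g : ℤ × ℤ × ℤ) : flipIso hτ g = heisFlip g := rfl

section Point

variable (hS : Admissible S)
include hS

/-- The conjugate flip `σ τ σ`. [folklore] -/
def flip1Iso : graph S ≃g graph S := (swapIso hS.swap).trans ((flipIso hS.flip).trans (swapIso hS.swap))

/-- The sign part of the point group. [folklore] -/
def signIso (ε : Fin 2 → ℤˣ) : graph S ≃g graph S :=
  (if ε 0 = 1 then SimpleGraph.Iso.refl (G := graph S) else flipIso hS.flip).trans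
    (if ε 1 = 1 then SimpleGraph.Iso.refl (G := graph S) else flip1Iso hS)

/-- **The lifted point group** `D₄ = HOct 2` of `Cay(H₃; S)`. [cite: CheegerKleinerNaor2011, §1.1] -/
def pointIso (g : HOct 2) : graph S ≃g graph S :=
  (if g.1 = 1 then SimpleGraph.Iso.refl (G := graph S) else swapIso hS.swap).trans (signIso hS g.2)

/-- The sign isomorphisms are the same FUNCTIONS as p4's `heisSignIso`. [folklore] -/
theorem signIso_apply (ε : Fin 2 → ℤˣ) (w : ℤ × ℤ × ℤ) : signIso hS ε w = heisSignIso ε w := by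
  unfold signIso flip1Iso heisSignIso heisFlip1Iso
  split_ifs <;> rfl

/-- The point isomorphisms are the same FUNCTIONS as p4's `heisPointIso`. [folklore] -/
theorem pointIso_apply (g : HOct 2) (w : ℤ × ℤ × ℤ) : pointIso hS g w = heisPointIso g w := by
  have h1 : ∀ v, signIso hS g.2 v = heisSignIso g.2 v := signIso_apply hS g.2
  unfold pointIso heisPointIso
  split_ifs
  · exact h1 w
  · exact h1 (heisSwap w)

/-- The point isomorphisms fix the identity. [folklore] -/
theorem pointIso_zero (g : HOct 2) : pointIso hS g ((0, 0, 0) : ℤ × ℤ × ℤ) = (0, 0, 0) := by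
  rw [pointIso_apply, heisPointIso_zero]

/-- **Equivariance**: `heisAb ∘ pointIso g = sp g ∘ heisAb`. [cite: CheegerKleinerNaor2011, §1.1] -/
theorem heisAb_pointIso (g : HOct 2) (w : ℤ × ℤ × ℤ) : heisAb (pointIso hS g w) = sp g (heisAb w) := by
  rw [pointIso_apply, heisAb_heisPointIso]

end Point

/-! ## §3 The `PlanarSkeletonConc` structure of `Cay(H₃; S)` -/

/-- Along an edge the abelianisation moves by at most one in each coordinate (unit steps). [folklore] -/
theorem abs_heisAb_sub_le_one (hsymm : ∀ s ∈ S, heisInv s ∈ S) (hunit : ∀ s ∈ S, |s.1| ≤ 1 ∧ |s.2.1| ≤ 1)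
    {g h : ℤ × ℤ × ℤ} (hgh : (graph S).Adj g h) (i : Fin 2) : |heisAb g i - heisAb h i| ≤ 1 := by
  rw [graph_adj_iff hsymm] at hgh
  obtain ⟨-, s, hs, rfl⟩ := hgh
  rw [heisAb_heisMul, Pi.add_apply, sub_add_cancel_left, abs_neg]
  obtain ⟨h1, h2⟩ := hunit s hs
  fin_cases i
  · simpa [heisAb] using h1
  · simpa [heisAb] using h2

/-- `g ≠ g·s` for `s ≠ 1`. [folklore] -/
theorem heisMul_ne_self {g s : ℤ × ℤ × ℤ} (hs : s ≠ (0, 0, 0)) : g ≠ heisMul g s := by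
  intro h
  apply hs
  have := heisMul_right_injective g (a₁ := (0, 0, 0)) (a₂ := s)
  exact (this (by simpa using h)).symm

/-- `g ∼ g·s` for `s ∈ S`, `s ≠ 1`. [folklore] -/
theorem adj_heisMul {g s : ℤ × ℤ × ℤ} (hs : s ∈ S) (hs0 : s ≠ (0, 0, 0)) : (graph S).Adj g (heisMul g s) :=
  (graph_adj_iff₀ _ _).2 ⟨heisMul_ne_self hs0, Or.inl ⟨s, hs, rfl⟩⟩

/-- **(ι) outward steps**: `a^{±1}, b^{±1}` move the abelianisation by `±e₀, ±e₁` at every vertex. [cite: CheegerKleinerNaor2011, §1.1] -/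
theorem step (hS : Admissible S) (v : ℤ × ℤ × ℤ) (i : Fin 2) (σ : ℤˣ) :
    ∃ v' : ℤ × ℤ × ℤ, (graph S).Adj v v' ∧ heisAb v' = heisAb v + Pi.single i (σ : ℤ) := by
  have hAi : heisInv genA ∈ S := hS.symm _ hS.genA_mem
  have hBi : heisInv genB ∈ S := hS.symm _ hS.genB_mem
  rcases Int.units_eq_one_or σ with rfl | rfl <;> fin_cases i
  · refine ⟨heisMul v genA, adj_heisMul hS.genA_mem (by simp [genA]), ?_⟩
    rw [heisAb_heisMul]; ext j; fin_cases j <;> simp [heisAb, genA]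
  · refine ⟨heisMul v genB, adj_heisMul hS.genB_mem (by simp [genB]), ?_⟩
    rw [heisAb_heisMul]; ext j; fin_cases j <;> simp [heisAb, genB]
  · refine ⟨heisMul v (heisInv genA), adj_heisMul hAi (by simp [genA, heisInv]), ?_⟩
    rw [heisAb_heisMul]; ext j; fin_cases j <;> simp [heisAb, genA, heisInv]
  · refine ⟨heisMul v (heisInv genB), adj_heisMul hBi (by simp [genB, heisInv]), ?_⟩
    rw [heisAb_heisMul]; ext j; fin_cases j <;> simp [heisAb, genB, heisInv]

/-- The induced cylinder graphs grow with the graph. [folklore] -/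
theorem induce_connected_mono {V : Type*} {G G' : SimpleGraph V} (hle : G ≤ G') (s : Set V) (h : (G.induce s).Connected) :
    (G'.induce s).Connected :=
  h.mono fun _ _ hadj => hle hadj

/-- **`Cay(H₃(ℤ); S)` carries the design-(D) interface** for every admissible `S`: skeleton `heisAb`, one base vertex, frames = left
translations, point group `D₄`, `Δ = 2|S|`, unit steps, connected cylinders (`ℓ ≥ 1`). [cite: KozmaNitzan2024, §4 p. 15] [cite: CheegerKleinerNaor2011, §1.1] -/
def skeletonConc (hS : Admissible S) : PlanarSkeletonConc (graph S) where
  φ := heisAb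
  lip := fun _ _ h i => abs_heisAb_sub_le_one hS.symm hS.unit h i
  types := {((0, 0, 0) : ℤ × ℤ × ℤ)}
  frame := fun v => ⟨(0, 0, 0), Finset.mem_singleton_self _, leftIso v, by simp, fun w => by
    rw [leftIso_apply, heisAb_heisMul, heisAb_zero, sub_zero, add_comm]⟩
  point := fun t ht g => by
    rw [Finset.mem_singleton] at ht
    subst ht
    refine ⟨pointIso hS g, pointIso_zero hS g, fun w => ?_⟩
    rw [heisAb_zero, sub_zero, sub_zero, heisAb_pointIso]
  Δ := 2 * S.card
  degree_le := degree_le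
  step := step hS
  cyl_connected := by
    intro t ht ℓ hℓ
    have ht' : t = (0, 0, 0) := by simpa using ht
    subst ht'
    have e : {w : ℤ × ℤ × ℤ | heisAb w - heisAb (0, 0, 0) ∈ box 2 ℓ} = heisCyl ℓ := heisSkeleton_cyl ℓ
    rw [e]
    exact induce_connected_mono (cayleyGraph_le hS.genA_mem hS.genB_mem) _ (heisCylGraph_connected hℓ)

/-- The skeleton map is `heisAb`. [folklore] -/
@[simp] theorem skeletonConc_φ (hS : Admissible S) : (skeletonConc hS).φ = heisAb := rfl

/-- The base vertices. [folklore] -/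
@[simp] theorem skeletonConc_types (hS : Admissible S) : (skeletonConc hS).types = {((0, 0, 0) : ℤ × ℤ × ℤ)} := rfl

/-- The cylinders at the identity are `{|x|, |y| ≤ ℓ}`. [folklore] -/
theorem skeletonConc_cyl (hS : Admissible S) (ℓ : ℕ) : (skeletonConc hS).toPlanarSkeleton.cyl ((0, 0, 0) : ℤ × ℤ × ℤ) ℓ = heisCyl ℓ :=
  heisSkeleton_cyl ℓ

end HeisGens

end Summit.CriticalPhenomena.PercolationContinuityZ3.Theorems.Transplant

end
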